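/-
Origin: expansion seat `prover-pub-hodgecm-mc-sinst-1-g5-0`, handover #1220 2026-08-20T09:46Z md5 acd1753331b4 (186 l., 7 theorems) NEW additive drop-alone leaf over vendored W2 files only (no rowdep); (VT) W5 generic: covariant pair ⇒ scalar (continuous Schur), the read-off `archRepMp` exactly covariant over archPhaseMap for all (p,q), and the (VT) skeleton `exists_eq_smul_comp_of_covariant_mul : A = c • Ω ∘ L`; NAME LIST: HodgeCM.Model.ArchLevi.exists_smul_of_covariant_pair · HodgeCM.Model.ArchLevi.archRepMp_rhoSD_exact · HodgeCM.Model.ArchLevi.exists_eq_smul_comp_of_covariant_mul (`HOME/mc/pub-hodgecm-mc-sinst-1-g5/stage/HodgeCM/Model/ArchCovariantSchur.lean`, md5 acd1753331b4, 186 lines);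
landed by the gen-18 packager (p-g18) in gate run 47 as `HodgeCM/Model/ArchCovariantSchur.lean` (verbatim).
-/
/-
Origin: speedrun cell pub-hodgecm, MODEL-CONSTRUCTION sub-cell, lineage mc-sinst-1 (S-instance constructor, BINDER-OWNERS row 5 `S` / row 6 `μ`: (J-μ) slots 2/3,
(VT) item W5 of `mc/pub-hodgecm-mc-period-1-g14/notes/STRIP-SCOPE.g14.md`, generic part), seat prover-pub-hodgecm-mc-sinst-1-g5-0 (gen 5), 2026-08-20.
Target in PKG: `HodgeCM/Model/ArchCovariantSchur.lean` (NEW additive leaf; imports only vendored W2 files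
`SegalBargmann/SchwartzHeisenbergSchur` (continuous Schur for `rhoSD`), `Weil1964/ArchSectionThetaMajorants` (`archPhaseMap_mul`),
`Weil1964/AdelicMetaplecticArchRepCovariant` (`archRepMp_rhoSD`); no rowdep).
KERNEL only: 0 records / `def … : Prop` / cites-as-hypotheses, 0 proof holes; intended closure {propext, Classical.choice, Quot.sound}.
-/
import Literature.Analysis.SegalBargmann.SchwartzHeisenbergSchur
import Literature.NumberTheory.Weil1964.ArchSectionThetaMajorants
import Literature.NumberTheory.Weil1964.AdelicMetaplecticArchRepCovariant

/-!
# Two operators exactly Heisenberg-covariant over the SAME phase-space map differ by a scalar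

(VT) item W5 (generic part) of period-1-g14's scoping note for the (J-μ) slots 2/3 junction (#1217 / #1218).  The vendored
continuous Schur lemma `SegalBargmann.eq_smul_of_commute_rhoSD` ([Folland1989, Prop. (1.50)]: a continuous operator on `𝓢(D)`
commuting with all `rhoSD e p q` is a scalar) is turned into the UNIQUENESS statement the (VT) lane consumes:

* §1 **`exists_smul_of_covariant_pair`** (any real carrier `D`, frame `e`, ANY self-map `γ` of `ℝ^σ × ℝ^σ`): if a continuous
  linear AUTOMORPHISM `A` and a continuous linear map `B` of `𝓢(D, ℂ)` are both exactly `rhoSD`-covariant over `γ`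
  (`X (rhoSD e p q Φ) = rhoSD e (γ(p,q)).1 (γ(p,q)).2 (X Φ)`), then `B = c • A` for one scalar `c` — `A⁻¹ ∘ B` commutes with
  every `rhoSD e p q` (no surjectivity of `γ` is needed).
* §2 **`archRepMp_rhoSD_exact`**: the archimedean read-off `ω_∞(h) = archRepMp s h` of a finite-trivial homomorphism
  `s : H →* Mp_ψ(W_𝔸)ᶜᵒⁿᵗ` is EXACTLY `rhoSD`-covariant over `archPhaseMap T e hT (π(s h))` for ALL `(p, q)` (the vendored
  `archRepMp_rhoSD` is the `(a, w)`-parametrised projective form; the cocycle is `1` by `ArchFollandCocycleOne`); the same for the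
  continuous versions `archRepMpCLM` / `archRepMpCLE`.
* §3 **`exists_eq_smul_comp_of_covariant_mul`**: if `A` is exactly covariant over `archPhaseMap (g₁ * g₂)`, an automorphism `Ω` over
  `archPhaseMap g₁` and an automorphism `L` over `archPhaseMap g₂`, then `A = c • Ω ∘ L` (`archPhaseMap_mul` + §1).
  This is the SHAPE of (VT): `A = A_∞` (the stripped archimedean implementer of the conjugated see-saw element `h₀ = g₁ g₂`, (STRIP)),
  `Ω = ω_∞(1, k)` (§2), `L = (Φ ↦ Φ ∘ P⁻¹)` the Levi model operator of `g₂ = m̃` (#1219 `ArchLevi.compCLM_symm_covariant_archPhaseMap`).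

Nothing here is specific to the see-saw datum; nothing is a claim of PerL/QW8; nothing is cited as a fact.

References: [Folland1989] G. B. Folland, *Harmonic Analysis in Phase Space*, Princeton UP 1989, Prop. (1.43), Prop. (1.50);
[MoeglinVignerasWaldspurger1987] C. Mœglin, M.-F. Vignéras, J.-L. Waldspurger, LNM 1291, Chap. 2 II.1 (A), II.2.
-/

set_option autoImplicit false

noncomputable section

open scoped Matrix SchwartzMap TensorProduct Classical
open Complex NumberField NumberField.mixedEmbedding IsDedekindDomain
open Literature.NumberTheory.Automorphic Literature.RepresentationTheory.HeisenbergGroup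
open Literature.Analysis.SegalBargmann Literature.NumberTheory.Weil1964

namespace HodgeCM.Model.ArchLevi

/-! ## §1 Covariant pairs differ by a scalar -/

section Generic

variable {σ : Type*} [Fintype σ] [DecidableEq σ]
variable {D : Type*} [NormedAddCommGroup D] [NormedSpace ℝ D]

/-- **Uniqueness of exactly covariant operators up to a scalar**: `A` a continuous linear automorphism and `B` a continuous
linear map of `𝓢(D, ℂ)`, both exactly `rhoSD e`-covariant over the same phase-space self-map `γ` ⇒ `B = c • A`.
[cite: Folland1989, Prop. (1.50); MoeglinVignerasWaldspurger1987, Chap. 2 II.2] -/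
theorem exists_smul_of_covariant_pair (e : D ≃L[ℝ] (σ → ℝ)) (γ : (σ → ℝ) × (σ → ℝ) → (σ → ℝ) × (σ → ℝ))
    (A : 𝓢(D, ℂ) ≃L[ℂ] 𝓢(D, ℂ)) (B : 𝓢(D, ℂ) →L[ℂ] 𝓢(D, ℂ))
    (hA : ∀ (p q : σ → ℝ) (Φ : 𝓢(D, ℂ)), A (rhoSD e p q Φ) = rhoSD e (γ (p, q)).1 (γ (p, q)).2 (A Φ))
    (hB : ∀ (p q : σ → ℝ) (Φ : 𝓢(D, ℂ)), B (rhoSD e p q Φ) = rhoSD e (γ (p, q)).1 (γ (p, q)).2 (B Φ)) :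
    ∃ c : ℂ, ∀ Φ : 𝓢(D, ℂ), B Φ = c • A Φ := by
  -- `A⁻¹` is covariant the other way round
  have hA' : ∀ (p q : σ → ℝ) (Ψ : 𝓢(D, ℂ)), A.symm (rhoSD e (γ (p, q)).1 (γ (p, q)).2 Ψ) = rhoSD e p q (A.symm Ψ) := by
    intro p q Ψ
    apply A.injective
    rw [ContinuousLinearEquiv.apply_symm_apply, hA, ContinuousLinearEquiv.apply_symm_apply]
  -- hence `T := A⁻¹ ∘ B` commutes with every `rhoSD e p q`
  obtain ⟨c, hc⟩ := eq_smul_of_commute_rhoSD e ((A.symm : 𝓢(D, ℂ) →L[ℂ] 𝓢(D, ℂ)).comp B) fun p q Φ => by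
    simp only [ContinuousLinearMap.comp_apply, ContinuousLinearEquiv.coe_coe]
    rw [hB, hA']
  refine ⟨c, fun Φ => ?_⟩
  have h := congrArg A (hc Φ)
  rw [ContinuousLinearMap.comp_apply, ContinuousLinearEquiv.coe_coe, ContinuousLinearEquiv.apply_symm_apply, map_smul] at h
  exact h

/-- Two continuous linear AUTOMORPHISMS exactly covariant over the same `γ` differ by a NONZERO scalar (given one vector on which
`B` does not vanish). [cite: Folland1989, Prop. (1.50)] -/
theorem exists_smul_of_covariant_pair_ne_zero (e : D ≃L[ℝ] (σ → ℝ)) (γ : (σ → ℝ) × (σ → ℝ) → (σ → ℝ) × (σ → ℝ))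
    (A : 𝓢(D, ℂ) ≃L[ℂ] 𝓢(D, ℂ)) (B : 𝓢(D, ℂ) →L[ℂ] 𝓢(D, ℂ))
    (hA : ∀ (p q : σ → ℝ) (Φ : 𝓢(D, ℂ)), A (rhoSD e p q Φ) = rhoSD e (γ (p, q)).1 (γ (p, q)).2 (A Φ))
    (hB : ∀ (p q : σ → ℝ) (Φ : 𝓢(D, ℂ)), B (rhoSD e p q Φ) = rhoSD e (γ (p, q)).1 (γ (p, q)).2 (B Φ))
    {Φ₀ : 𝓢(D, ℂ)} (hΦ₀ : B Φ₀ ≠ 0) :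
    ∃ c : ℂ, c ≠ 0 ∧ ∀ Φ : 𝓢(D, ℂ), B Φ = c • A Φ := by
  obtain ⟨c, hc⟩ := exists_smul_of_covariant_pair e γ A B hA hB
  refine ⟨c, fun h0 => hΦ₀ ?_, hc⟩
  rw [hc, h0, zero_smul]

omit [DecidableEq σ] in
/-- **Composition of covariances**: `X` exactly covariant over `γ`, `Y` over `δ` ⇒ `X ∘ Y` over `γ ∘ δ`. [folklore] -/
theorem covariant_trans (e : D ≃L[ℝ] (σ → ℝ)) {γ δ : (σ → ℝ) × (σ → ℝ) → (σ → ℝ) × (σ → ℝ)}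
    (X Y : 𝓢(D, ℂ) ≃L[ℂ] 𝓢(D, ℂ))
    (hX : ∀ (p q : σ → ℝ) (Φ : 𝓢(D, ℂ)), X (rhoSD e p q Φ) = rhoSD e (γ (p, q)).1 (γ (p, q)).2 (X Φ))
    (hY : ∀ (p q : σ → ℝ) (Φ : 𝓢(D, ℂ)), Y (rhoSD e p q Φ) = rhoSD e (δ (p, q)).1 (δ (p, q)).2 (Y Φ))
    (p q : σ → ℝ) (Φ : 𝓢(D, ℂ)) :
    (Y.trans X) (rhoSD e p q Φ) = rhoSD e (γ (δ (p, q))).1 (γ (δ (p, q))).2 ((Y.trans X) Φ) := by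
  rw [ContinuousLinearEquiv.trans_apply, hY, hX, ContinuousLinearEquiv.trans_apply]

end Generic

/-! ## §2 The archimedean read-off is EXACTLY covariant over `archPhaseMap`, for all `(p, q)` -/

section ReadOff

variable {F : Type} [Field F] [NumberField F] {ι : Type} [Fintype ι] [DecidableEq ι]
  {T : Matrix ι ι (AdeleRing (𝓞 F) F)} {H : Type*} [Group H]
  (hTy : Function.Surjective fun y : ι → AdeleRing (𝓞 F) F => T *ᵥ y) (s : H →* adelicMpCont F ι T)
  (hfin : ∀ h, ∀ w ∈ finHeisenberg T,
    (ofSymplectic (polar (adelicForm F ι T)) (adelicMpCont.proj F ι T (s h))).act w = w)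

/-- **`ω_∞(h) (rhoSD e p q Φ) = rhoSD e (archPhaseMap T e hT (π (s h)) (p,q)).1 (…).2 (ω_∞(h) Φ)` for ALL `(p, q)`** — the vendored
projective covariance `archRepMp_rhoSD` with the Folland cocycle gone (`arch_covariant_rhoSD_exact`).
[cite: Folland1989, Prop. (1.43); MoeglinVignerasWaldspurger1987, Chap. 2 II.1 (A)] -/
theorem archRepMp_rhoSD_exact {σ : Type*} [Fintype σ] (e : (ι → mixedSpace F) ≃L[ℝ] (σ → ℝ))
    (hT : IsUnit (archMat F ι T)) (h : H) (p q : σ → ℝ) (Φ : 𝓢((ι → mixedSpace F), ℂ)) :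
    archRepMp hTy s hfin h (rhoSD e p q Φ) =
      rhoSD e (archPhaseMap T e hT (adelicMpCont.proj F ι T (s h)) (p, q)).1
        (archPhaseMap T e hT (adelicMpCont.proj F ι T (s h)) (p, q)).2 (archRepMp hTy s hfin h Φ) :=
  arch_covariant_rhoSD_exact T e hT (adelicMpCont.proj F ι T (s h)) _ (implements_adelicMpCont_proj (s h))
    (archRepMp hTy s hfin h) LinearMap.id (fun Φ' f => omega_map_tmul hTy s hfin h Φ' f)
    id_indicatorSB_top_ne_zero p q Φ

/-- The same for the continuous automorphism `archRepMpCLE`. [cite: Folland1989, Prop. (1.43)] -/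
theorem archRepMpCLE_rhoSD_exact {σ : Type*} [Fintype σ] (e : (ι → mixedSpace F) ≃L[ℝ] (σ → ℝ))
    (hT : IsUnit (archMat F ι T)) (h : H) (p q : σ → ℝ) (Φ : 𝓢((ι → mixedSpace F), ℂ)) :
    archRepMpCLE hTy s hfin h (rhoSD e p q Φ) =
      rhoSD e (archPhaseMap T e hT (adelicMpCont.proj F ι T (s h)) (p, q)).1
        (archPhaseMap T e hT (adelicMpCont.proj F ι T (s h)) (p, q)).2 (archRepMpCLE hTy s hfin h Φ) :=
  archRepMp_rhoSD_exact hTy s hfin e hT h p q Φ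

end ReadOff

/-! ## §3 The shape of (VT): `A = c • Ω ∘ L` -/

section Assembly

variable {F : Type} [Field F] [NumberField F] {ι : Type} [Fintype ι] [DecidableEq ι]
  (T : Matrix ι ι (AdeleRing (𝓞 F) F))

/-- **(VT) skeleton**: `A` exactly covariant over `archPhaseMap (g₁ * g₂)`, the automorphism `Ω` over `archPhaseMap g₁`, the
automorphism `L` over `archPhaseMap g₂` ⇒ `A = c • (Ω ∘ L)` for one scalar `c`. [cite: Folland1989, Prop. (1.50)] -/
theorem exists_eq_smul_comp_of_covariant_mul {σ : Type*} [Fintype σ] [DecidableEq σ]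
    (e : (ι → mixedSpace F) ≃L[ℝ] (σ → ℝ)) (hT : IsUnit (archMat F ι T))
    (g₁ g₂ : symplecticGroup (polar (adelicForm F ι T)))
    (A : 𝓢((ι → mixedSpace F), ℂ) →L[ℂ] 𝓢((ι → mixedSpace F), ℂ))
    (Ω L : 𝓢((ι → mixedSpace F), ℂ) ≃L[ℂ] 𝓢((ι → mixedSpace F), ℂ))
    (hA : ∀ (p q : σ → ℝ) (Φ : 𝓢((ι → mixedSpace F), ℂ)), A (rhoSD e p q Φ) =
      rhoSD e (archPhaseMap T e hT (g₁ * g₂) (p, q)).1 (archPhaseMap T e hT (g₁ * g₂) (p, q)).2 (A Φ))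
    (hΩ : ∀ (p q : σ → ℝ) (Φ : 𝓢((ι → mixedSpace F), ℂ)), Ω (rhoSD e p q Φ) =
      rhoSD e (archPhaseMap T e hT g₁ (p, q)).1 (archPhaseMap T e hT g₁ (p, q)).2 (Ω Φ))
    (hL : ∀ (p q : σ → ℝ) (Φ : 𝓢((ι → mixedSpace F), ℂ)), L (rhoSD e p q Φ) =
      rhoSD e (archPhaseMap T e hT g₂ (p, q)).1 (archPhaseMap T e hT g₂ (p, q)).2 (L Φ)) :
    ∃ c : ℂ, ∀ Φ : 𝓢((ι → mixedSpace F), ℂ), A Φ = c • Ω (L Φ) := by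
  have hΩL : ∀ (p q : σ → ℝ) (Φ : 𝓢((ι → mixedSpace F), ℂ)), (L.trans Ω) (rhoSD e p q Φ) =
      rhoSD e (archPhaseMap T e hT (g₁ * g₂) (p, q)).1 (archPhaseMap T e hT (g₁ * g₂) (p, q)).2 ((L.trans Ω) Φ) := by
    intro p q Φ
    rw [archPhaseMap_mul]
    exact covariant_trans e Ω L hΩ hL p q Φ
  obtain ⟨c, hc⟩ := exists_smul_of_covariant_pair e (archPhaseMap T e hT (g₁ * g₂)) (L.trans Ω) A hΩL hA
  exact ⟨c, fun Φ => by rw [hc Φ, ContinuousLinearEquiv.trans_apply]⟩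

/-- … with `c ≠ 0` as soon as `A Φ₀ ≠ 0` for one `Φ₀`. [cite: Folland1989, Prop. (1.50)] -/
theorem exists_eq_smul_comp_of_covariant_mul_ne_zero {σ : Type*} [Fintype σ] [DecidableEq σ]
    (e : (ι → mixedSpace F) ≃L[ℝ] (σ → ℝ)) (hT : IsUnit (archMat F ι T))
    (g₁ g₂ : symplecticGroup (polar (adelicForm F ι T)))
    (A : 𝓢((ι → mixedSpace F), ℂ) →L[ℂ] 𝓢((ι → mixedSpace F), ℂ))
    (Ω L : 𝓢((ι → mixedSpace F), ℂ) ≃L[ℂ] 𝓢((ι → mixedSpace F), ℂ))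
    (hA : ∀ (p q : σ → ℝ) (Φ : 𝓢((ι → mixedSpace F), ℂ)), A (rhoSD e p q Φ) =
      rhoSD e (archPhaseMap T e hT (g₁ * g₂) (p, q)).1 (archPhaseMap T e hT (g₁ * g₂) (p, q)).2 (A Φ))
    (hΩ : ∀ (p q : σ → ℝ) (Φ : 𝓢((ι → mixedSpace F), ℂ)), Ω (rhoSD e p q Φ) =
      rhoSD e (archPhaseMap T e hT g₁ (p, q)).1 (archPhaseMap T e hT g₁ (p, q)).2 (Ω Φ))
    (hL : ∀ (p q : σ → ℝ) (Φ : 𝓢((ι → mixedSpace F), ℂ)), L (rhoSD e p q Φ) =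
      rhoSD e (archPhaseMap T e hT g₂ (p, q)).1 (archPhaseMap T e hT g₂ (p, q)).2 (L Φ))
    {Φ₀ : 𝓢((ι → mixedSpace F), ℂ)} (hΦ₀ : A Φ₀ ≠ 0) :
    ∃ c : ℂ, c ≠ 0 ∧ ∀ Φ : 𝓢((ι → mixedSpace F), ℂ), A Φ = c • Ω (L Φ) := by
  obtain ⟨c, hc⟩ := exists_eq_smul_comp_of_covariant_mul T e hT g₁ g₂ A Ω L hA hΩ hL
  refine ⟨c, fun h0 => hΦ₀ ?_, hc⟩
  rw [hc, h0, zero_smul]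

end Assembly

end HodgeCM.Model.ArchLevi

end
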